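import Mathlib
import Summits.MatrixMultiplication.MatrixMultiplication.Theses.AutomaticSTPPDesigns
import Summits.MatrixMultiplication.MatrixMultiplication.Theorems.AutomaticSTPPDesignsAutomaticDesignBelowFourFifthsTransfer
import Literature.Computability.AlgebraicComplexity.GroupTheoreticMatMul
import Literature.Computability.AlgebraicComplexity.BigCwLaserSupport
import Literature.Computability.AlgebraicComplexity.BigCwLaserBound
import Literature.Computability.AutomaticStructures.AutomaticBlock

/-!
# Line `digit-sum-sliced-laser` for crux `AutomaticDesignBelowFourFifths`
(stmt-MatrixMultiplication-7357, route `AutomaticSTPPDesigns`) — SKELETON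

Idea card `Cruxes/AutomaticDesignBelowFourFifths/Ideas/digit-sum-sliced-laser.md` (triage r2: pass, pass).

**Claim of the line.** Coppersmith–Winograd's level-1 laser design for `CW_6`, read inside the
carry-free truncated convolution `T_8^lower` (digits `0 ↦ level 0`, `1…6 ↦ level 1`, `7 ↦ level 2`)
and SLICED to constant digit sums, is an honest STPP family in ONE cyclic group `ℤ/8^N`
(`N = 3a + 3b`, `a = 18c`, `b = c`), and for `c ≥ 10^6` its packing sum at exponent `4/5` exceeds
`8^N`.  By the LANDED normal form `AutomaticDesignBelowFourFifths.crux_of_cyclicDesign`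
(C⁺ → crux; `Theorems/AutomaticSTPPDesignsAutomaticDesignBelowFourFifthsTransfer.lean`) this proves
the crux.

**The lever (stub 2, Kummer's carry identity).** If `[x] + [y] = [z]` in `ℤ/ℓ^N` for digit vectors
`x y z ∈ [0,ℓ)^N` whose digit sums satisfy `s(x) + s(y) = s(z)`, then `x_t + y_t = z_t` digit by digit
(every carry costs `ℓ - 1` units of digit sum, a wrap costs at least one): on constant-digit-sum
slices the structure tensor of `ℤ/ℓ^N` IS the `N`-th power of `T_ℓ^lower`.

**Architecture** (composition `AutomaticDesignBelowFourFifths_of`, kernel-checked modulo `stub_*`;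
every stub is DEF-FREE, stated over Mathlib + tree vocabulary — `letterCount`, `digitValue`,
`IsSTPP`, `rothNumberNat`, `Nat.multinomial` — so each lands verbatim as its own
`Theorems/AutomaticSTPPDesignsAutomaticDesignBelowFourFifthsStub<Name>.lean` with `--supports`):

1. `stub_typedFreeDiagonal` — the tree's free diagonal `exists_free_bigCw_diagonal a b`
   (BigCwLaserSupport.lean: weight 2 pointwise, pattern counts `a,a,a`, freeness, size
   `binom(N; a+2b,2a,b)·roth(3f) ≤ 288 f |Δ|`) RE-EXPORTED WITH THE TYPES of the three level
   sequences (`letterCount = (a+2b, 2a, b)`; its proof has `Δ ⊆ Φ` typed, L362–368/L492–502).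
2. `stub_digitwise` — Kummer: value relation mod `ℓ^N` + digit-sum conservation ⇒ digitwise.
3. `stub_slicedSTPP` (HARDEST) — for a typed free diagonal `Δ` over `Fin N → Fin 3`, `ℓ = q + 2`,
   a slice `Sl ⊆ (Fin a → Fin q)` of constant coordinate sum, and the digitwise property of `ℓ, N`
   as a hypothesis: there are `A B C : Fin |Δ| → Finset (ZMod (ℓ^N))`, `IsSTPP A B C`, all blocks of
   size `|Sl|`.  Construction (card §(5), B and C NEGATED): for `δ = (I,J,K) ∈ Δ` with pattern classes
   `P₁ = (0,1,1)`, `P₂ = (1,0,1)`, `P₃ = (1,1,0)` (each of size `a`), `Q₁ = (0,0,2)`, `Q₂ = (0,2,0)`,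
   `Q₃ = (2,0,0)` (each of size `b` by the types):
   `A_δ = {[ (ℓ-1)·1_{Q₃} + (κ+1) on P₂ ] : κ ∈ Sl}`, `B_δ = {-[ (μ+1) on P₃ ] : μ ∈ Sl}`,
   `C_δ = {-[ (ℓ-1)·1_{Q₂ ∪ P₃} + (ν+1) on P₁ ] : ν ∈ Sl}` (slices transported to the classes by
   `orderIsoOfFin`).  Then `A_i - B_i`, `B_j - C_j`, `A_k - C_k` are values of NON-NEGATIVE digit
   vectors `x, y, z` with level sequences `I_i, J_j, K_k` (z-levels reversed: digit `c ↦ level of ℓ-1-c`)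
   and constant digit sums `(ℓ-1)b + 2(σ+a)`, `(ℓ-1)(a+b)`, `(ℓ-1)(a+2b) + 2(σ+a)`; the STPP relation
   `(s'-s)+(t'-t)+(u'-u) = 0` is `[x] + [y] = [z]`, hence digitwise (stub 2); per coordinate the level
   weight of `(x_t, y_t, z_t)` with `x_t + y_t = z_t < ℓ` is `≥ 2` (`= 3` only for the junk pattern
   `(1,1,1)`), the total is `wt I_i + wt J_j + wt K_k = 3(2a+2b) = 2N` by the types, so every
   coordinate has weight exactly 2, freeness gives `i = j = k`, and the shared free digits agree:
   `s = s'`, `t = t'`, `u = u'`.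
4. `stub_packingCount` — numerics at `q = 6`, `β = 1/19` (`a = 18c`, `b = c`, `c ≥ 10^6`): from the
   size clause (`log |Δ| ≥ N·H(20/57,12/19,1/57) - 20√N - log 96`, tree `log_laserDiagonal_lower`)
   and the slice bound `6^a ≤ (5a+1)|Sl|`: `8^N < |Δ|·(|Sl|³)^{4/5}`.  Per coordinate the slack is
   `H + (4/5)(18/19) log 6 - log 8 = +0.0071635` nats (CW 1990 §7: `ω < 2.38719 < 2.4`); the margin
   `0.40844c - 20√(57c) - log 96 - 2.4 log(90c+1)` is `+2.57·10^5` nats at `c = 10^6` and increasing.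

Glue PROVED here: `exists_slice` (pigeonhole on digit sums) and the composition.

Disproof used: none exists for this crux (payload `disproof_path` absent on disk; `ledger crux ls`
lists no Disproof.lean, 2026-08-16) — no `_false_without_` to honour; no landed `Negative/` lemma.
-/

-- single-conjunct summit: the mandated namespace repeats `MatrixMultiplication`.
set_option linter.dupNamespace false

noncomputable section

open Finset
open scoped BigOperators

namespace Summit.MatrixMultiplication.MatrixMultiplication.Cruxes.AutomaticDesignBelowFourFifths.DigitSumSlicedLaser

open Literature.Computability.AlgebraicComplexity (IsSTPP letterCount)
open Literature.Computability.AutomaticStructures (digitValue)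

/-! ## Stub 1 — the typed free diagonal (re-export of `exists_free_bigCw_diagonal`) -/

/-- **Typed free diagonal** (stub; = `Literature.Computability.AlgebraicComplexity.exists_free_bigCw_diagonal a b`
with the nine letter counts of `Φ` kept in the export — its proof already has `Δ ⊆ Φ`,
BigCwLaserSupport.lean L362–368 (`hmem`) and L492 (`hΔΦ`); BCS 1997 Thm 15.41 (B), p. 381/384):
a family `Δ` of level triples `(I, J, K) ∈ ({0,1,2}^{3a+3b})³` with `I + J + K ≡ 2` pointwise,
`a` positions of each pattern `(1,1,·), (0,1,·), (1,0,·)`, all three sequences of type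
`(#0,#1,#2) = (a+2b, 2a, b)`, FREE (`I_δ + J_δ' + K_δ'' ≡ 2 ⇒ δ = δ' = δ''`), with
`binom(3a+3b; a+2b, 2a, b) · rothNumberNat(3f) ≤ 288 f |Δ|`, `f = C(2a,a) C(a+2b,a) C(2b,b)`. -/
theorem stub_typedFreeDiagonal :
    ∀ a b : ℕ,
    ∃ Δ : Finset ((Fin (3 * a + 3 * b) → Fin 3) × (Fin (3 * a + 3 * b) → Fin 3) ×
        (Fin (3 * a + 3 * b) → Fin 3)),
      (∀ δ ∈ Δ, ∀ t, (δ.1 t : ℕ) + δ.2.1 t + δ.2.2 t = 2) ∧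
      (∀ δ ∈ Δ, (univ.filter fun t => δ.1 t = 1 ∧ δ.2.1 t = 1).card = a ∧
        (univ.filter fun t => δ.1 t = 0 ∧ δ.2.1 t = 1).card = a ∧
        (univ.filter fun t => δ.1 t = 1 ∧ δ.2.1 t = 0).card = a) ∧
      (∀ δ ∈ Δ,
        (letterCount δ.1 0 = a + 2 * b ∧ letterCount δ.1 1 = 2 * a ∧ letterCount δ.1 2 = b) ∧
        (letterCount δ.2.1 0 = a + 2 * b ∧ letterCount δ.2.1 1 = 2 * a ∧
          letterCount δ.2.1 2 = b) ∧
        (letterCount δ.2.2 0 = a + 2 * b ∧ letterCount δ.2.2 1 = 2 * a ∧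
          letterCount δ.2.2 2 = b)) ∧
      (∀ δ ∈ Δ, ∀ δ' ∈ Δ, ∀ δ'' ∈ Δ,
        (∀ t, (δ.1 t : ℕ) + δ'.2.1 t + δ''.2.2 t = 2) → δ = δ' ∧ δ' = δ'') ∧
      Nat.multinomial univ ![a + 2 * b, 2 * a, b] *
          rothNumberNat (3 * ((2 * a).choose a * ((a + 2 * b).choose a * (2 * b).choose b))) ≤
        288 * ((2 * a).choose a * ((a + 2 * b).choose a * (2 * b).choose b)) * Δ.card := by
  sorry

/-! ## Stub 2 — Kummer: digit-sum conservation forbids carries -/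

/-- **Digitwise from digit-sum conservation** (stub; Kummer 1852 / Legendre: `s(x) + s(y) =
s(x+y) + (ℓ-1)·#carries`, and a wrap past `ℓ^N` costs at least one more unit): if
`[x]_ℓ + [y]_ℓ = [z]_ℓ` in `ℤ/ℓ^N` for digit vectors `x y z : Fin N → Fin ℓ` (`ℓ ≥ 2`) and
`∑ x_t + ∑ y_t = ∑ z_t`, then `x_t + y_t = z_t` for every `t`.  (Tree route: the carry recursion
`intCast_sum_mul_pow_eq_zero_iff` with digits `d_t = x_t + y_t - z_t ∈ [-(ℓ-1), 2ℓ-2]` forces carries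
in `{0,1}`; summing the recursion, `∑ d_t = (ℓ-1) ∑_{0<t<N} c_t + ℓ c_N = 0` kills them all.
Mathlib has the Legendre form `Nat.sub_one_mul_sum_div_pow_eq_sub_sum_digits`.) -/
theorem stub_digitwise :
    ∀ (ℓ N : ℕ), 2 ≤ ℓ → ∀ x y z : Fin N → Fin ℓ,
      (digitValue x : ZMod (ℓ ^ N)) + (digitValue y : ZMod (ℓ ^ N)) =
          (digitValue z : ZMod (ℓ ^ N)) →
      (∑ t, (x t : ℕ)) + (∑ t, (y t : ℕ)) = ∑ t, (z t : ℕ) →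
      ∀ t, (x t : ℕ) + y t = z t := by
  sorry

/-! ## Stub 3 — the sliced laser family is STPP in `ℤ/ℓ^N` (HARDEST) -/

/-- **The sliced level-1 laser family is an STPP family of one cyclic group** (stub, load-bearing;
CW 1990 §7 / BCS Thm 15.41 blocks read in `T_ℓ^lower`, `ℓ = q + 2`, AVW 2018 §7.3; CKSU 2005
Def 5.1 in the tree's `IsSTPP` orientation `(s'-t) + (t'-u) = (s-u')`).  Data: a set `Δ` of level
triples over `Fin N` which is pointwise of weight 2, has `a` positions of each pattern
`(1,1,·), (0,1,·), (1,0,·)`, is TYPED `(a+2b, 2a, b)` in all three components and FREE; a slice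
`Sl ⊆ (Fin a → Fin q)` of constant coordinate sum `σ` (digit `κ_t + 1 ∈ [1,q]`); and the digitwise
property of `(ℓ, N)` (= `stub_digitwise ℓ N`).  Conclusion: an `IsSTPP` family
`A B C : Fin |Δ| → Finset (ZMod (ℓ^N))` with `|A_i| = |B_i| = |C_i| = |Sl|`.
Intended witnesses (module docstring §3): `A_δ = {[(ℓ-1)·1_{Q₃(δ)} + (κ+1)·on P₂(δ)]}`,
`B_δ = {-[(μ+1) on P₃(δ)]}`, `C_δ = {-[(ℓ-1)·1_{Q₂(δ) ∪ P₃(δ)} + (ν+1) on P₁(δ)]}`, `κ, μ, ν ∈ Sl`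
transported by `orderIsoOfFin`; then the three difference sets are values of non-negative digit
vectors with level sequences `δ.1, δ.2.1, δ.2.2` (z reversed) and constant digit sums
`(ℓ-1)b + 2(σ+a)`, `(ℓ-1)(a+b)`, `(ℓ-1)(a+2b) + 2(σ+a)`; digitwise ⇒ pointwise weight `≥ 2` with total
`= 2N` by the types (`N = 3a+3b` from `sum_letterCount`) ⇒ weight 2 everywhere ⇒ freeness ⇒
`i = j = k` ⇒ shared digits agree. -/
theorem stub_slicedSTPP :
    ∀ (q ℓ N a b : ℕ), 1 ≤ q → q + 2 = ℓ →
      (∀ x y z : Fin N → Fin ℓ,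
        (digitValue x : ZMod (ℓ ^ N)) + (digitValue y : ZMod (ℓ ^ N)) =
            (digitValue z : ZMod (ℓ ^ N)) →
        (∑ t, (x t : ℕ)) + (∑ t, (y t : ℕ)) = ∑ t, (z t : ℕ) → ∀ t, (x t : ℕ) + y t = z t) →
      ∀ Δ : Finset ((Fin N → Fin 3) × (Fin N → Fin 3) × (Fin N → Fin 3)),
        (∀ δ ∈ Δ, ∀ t, (δ.1 t : ℕ) + δ.2.1 t + δ.2.2 t = 2) →
        (∀ δ ∈ Δ, (univ.filter fun t => δ.1 t = 1 ∧ δ.2.1 t = 1).card = a ∧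
          (univ.filter fun t => δ.1 t = 0 ∧ δ.2.1 t = 1).card = a ∧
          (univ.filter fun t => δ.1 t = 1 ∧ δ.2.1 t = 0).card = a) →
        (∀ δ ∈ Δ,
          (letterCount δ.1 0 = a + 2 * b ∧ letterCount δ.1 1 = 2 * a ∧ letterCount δ.1 2 = b) ∧
          (letterCount δ.2.1 0 = a + 2 * b ∧ letterCount δ.2.1 1 = 2 * a ∧
            letterCount δ.2.1 2 = b) ∧
          (letterCount δ.2.2 0 = a + 2 * b ∧ letterCount δ.2.2 1 = 2 * a ∧
            letterCount δ.2.2 2 = b)) →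
        (∀ δ ∈ Δ, ∀ δ' ∈ Δ, ∀ δ'' ∈ Δ,
          (∀ t, (δ.1 t : ℕ) + δ'.2.1 t + δ''.2.2 t = 2) → δ = δ' ∧ δ' = δ'') →
        ∀ (Sl : Finset (Fin a → Fin q)) (σ : ℕ), (∀ κ ∈ Sl, ∑ t, (κ t : ℕ) = σ) →
          ∃ A B C : Fin Δ.card → Finset (ZMod (ℓ ^ N)),
            IsSTPP A B C ∧
              ∀ i, (A i).card = Sl.card ∧ (B i).card = Sl.card ∧ (C i).card = Sl.card := by
  sorry

/-! ## Stub 4 — the packing sum beats `8^N` at `q = 6`, `β = 1/19`, `c ≥ 10^6` -/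

/-- **Packing count** (stub; numerics of CW 1990 §7 at `τ = 4/5`: with `a = 18c`, `b = c`,
`N = 57c`, the size clause of the free diagonal gives `log p ≥ N·H(20/57, 12/19, 1/57) - 20√N - log 96`
(tree `log_laserDiagonal_lower`, BigCwLaserBound.lean), the slice bound gives
`log S ≥ a log 6 - log(5a+1)`, and `57·H + (12/5)·18·log 6 - 57 log 8 = 0.40844 > 0` per unit of `c`
beats `20√(57c) + log 96 + 2.4 log(90c+1)` from `c = 10^6` on (margin `2.57·10^5` nats there);
log constants as in `BCS1997_cor1545`: `log 2` (Mathlib d9), `log 3`, `log 5`, `log 19`). -/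
theorem stub_packingCount :
    ∀ (a b c p S : ℕ), a = 18 * c → b = c → 1000000 ≤ c →
      Nat.multinomial univ ![a + 2 * b, 2 * a, b] *
          rothNumberNat (3 * ((2 * a).choose a * ((a + 2 * b).choose a * (2 * b).choose b))) ≤
        288 * ((2 * a).choose a * ((a + 2 * b).choose a * (2 * b).choose b)) * p →
      6 ^ a ≤ (5 * a + 1) * S →
      ((8 ^ (3 * a + 3 * b) : ℕ) : ℝ) < (p : ℝ) * (((S * S * S : ℕ) : ℝ)) ^ ((4 : ℝ) / 5) := by
  sorry

/-! ## Glue (proved): a large constant-digit-sum slice by pigeonhole -/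

/-- **Pigeonhole slice.** Among the `q^a` vectors `Fin a → Fin q` some coordinate sum `σ` is taken
at least `q^a / ((q-1)a + 1)` times (the sums lie in `[0, (q-1)a]`). -/
theorem exists_slice (q a : ℕ) :
    ∃ (Sl : Finset (Fin a → Fin q)) (σ : ℕ), (∀ κ ∈ Sl, ∑ t, (κ t : ℕ) = σ) ∧
      q ^ a ≤ ((q - 1) * a + 1) * Sl.card := by
  classical
  -- the coordinate-sum map lands in `range ((q-1) a + 1)`
  set T : Finset ℕ := range ((q - 1) * a + 1) with hT
  set ds : (Fin a → Fin q) → ℕ := fun κ => ∑ t, (κ t : ℕ) with hds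
  have hmaps : Set.MapsTo ds ↑(univ : Finset (Fin a → Fin q)) ↑T := by
    intro κ _
    rw [mem_coe, hT, mem_range]
    have hle : ∀ t, (κ t : ℕ) ≤ q - 1 := fun t => Nat.le_sub_one_of_lt (κ t).isLt
    calc ds κ = ∑ t, (κ t : ℕ) := rfl
      _ ≤ ∑ _t : Fin a, (q - 1) := sum_le_sum fun t _ => hle t
      _ = (q - 1) * a := by rw [sum_const, card_univ, Fintype.card_fin, smul_eq_mul, mul_comm]
      _ < (q - 1) * a + 1 := Nat.lt_succ_self _
  have hTne : T.Nonempty := ⟨0, by rw [hT, mem_range]; omega⟩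
  obtain ⟨σ, -, hmax⟩ :=
    exists_max_image T (fun y => (univ.filter fun κ : Fin a → Fin q => ds κ = y).card) hTne
  refine ⟨univ.filter fun κ => ds κ = σ, σ, fun κ hκ => (mem_filter.1 hκ).2, ?_⟩
  calc q ^ a = (univ : Finset (Fin a → Fin q)).card := by
        rw [card_univ, Fintype.card_fun, Fintype.card_fin, Fintype.card_fin]
    _ = ∑ y ∈ T, (univ.filter fun κ : Fin a → Fin q => ds κ = y).card :=
        card_eq_sum_card_fiberwise hmaps
    _ ≤ ∑ _y ∈ T, (univ.filter fun κ : Fin a → Fin q => ds κ = σ).card := sum_le_sum hmax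
    _ = T.card * (univ.filter fun κ : Fin a → Fin q => ds κ = σ).card := by
        rw [sum_const, smul_eq_mul]
    _ = ((q - 1) * a + 1) * (univ.filter fun κ : Fin a → Fin q => ds κ = σ).card := by
        rw [hT, card_range]

/-! ## Composition: the crux from the four stubs and the landed normal form -/

/-- **The crux `AutomaticDesignBelowFourFifths` from the line** (`q = 6`, `ℓ = 8`, `a = 18c`, `b = c`,
`c = 10^6` kept opaque so that no numeral power is ever evaluated): typed free diagonal (stub 1) →
pigeonhole slice (`exists_slice`) → sliced STPP family in `ℤ/8^{3a+3b}` (stub 3 fed with stub 2) →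
packing sum `> 8^{3a+3b}` (stub 4) → C⁺ → crux (`AutomaticDesignBelowFourFifths.crux_of_cyclicDesign`,
LANDED). -/
theorem AutomaticDesignBelowFourFifths_of :
    Summit.MatrixMultiplication.MatrixMultiplication.Theses.AutomaticSTPPDesigns.AutomaticDesignBelowFourFifths := by
  classical
  -- parameters, opaque
  obtain ⟨c, hc⟩ : ∃ c : ℕ, 1000000 ≤ c := ⟨1000000, le_rfl⟩
  obtain ⟨a, ha⟩ : ∃ a : ℕ, a = 18 * c := ⟨_, rfl⟩
  obtain ⟨b, hb⟩ : ∃ b : ℕ, b = c := ⟨_, rfl⟩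
  -- stub 1: the typed free diagonal
  obtain ⟨Δ, hwt, hpat, htyp, hfree, hsize⟩ := stub_typedFreeDiagonal a b
  -- a large slice of constant digit sum
  obtain ⟨Sl, σ, hSl, hslice⟩ := exists_slice 6 a
  have hslice' : 6 ^ a ≤ (5 * a + 1) * Sl.card := by
    simpa only [show (6 - 1 : ℕ) = 5 by norm_num] using hslice
  -- stub 3 (fed with stub 2): the sliced family is STPP in `ℤ/8^(3a+3b)`
  obtain ⟨A, B, C, hS, hcard⟩ :=
    stub_slicedSTPP 6 8 (3 * a + 3 * b) a b (by norm_num) rfl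
      (stub_digitwise 8 (3 * a + 3 * b) (by norm_num)) Δ hwt hpat htyp hfree Sl σ hSl
  -- stub 4: the packing sum beats the host
  have hlt := stub_packingCount a b c Δ.card Sl.card ha hb hc hsize hslice'
  -- C⁺, then the landed normal form
  refine Summit.MatrixMultiplication.MatrixMultiplication.Theorems.AutomaticDesignBelowFourFifths.crux_of_cyclicDesign
    ⟨8 ^ (3 * a + 3 * b), Δ.card, ?_, A, B, C, hS, ?_⟩
  · -- `2 ≤ 8 ^ (3a+3b)`
    have hN : 1 ≤ 3 * a + 3 * b := by omega
    calc (2 : ℕ) ≤ 8 ^ 1 := by norm_num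
      _ ≤ 8 ^ (3 * a + 3 * b) := Nat.pow_le_pow_right (by norm_num) hN
  · -- the packing sum is `|Δ| · (|Sl|³)^{4/5}`
    have hterm : ∀ i : Fin Δ.card,
        (((A i).card * (B i).card * (C i).card : ℕ) : ℝ) ^ ((4 : ℝ) / 5) =
          (((Sl.card * Sl.card * Sl.card : ℕ) : ℝ)) ^ ((4 : ℝ) / 5) := by
      intro i
      obtain ⟨h1, h2, h3⟩ := hcard i
      rw [h1, h2, h3]
    rw [sum_congr rfl fun i _ => hterm i, sum_const, card_univ, Fintype.card_fin, nsmul_eq_mul]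
    exact hlt

end Summit.MatrixMultiplication.MatrixMultiplication.Cruxes.AutomaticDesignBelowFourFifths.DigitSumSlicedLaser

end
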